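import Mathlib
import HarnessLib
import Summits.HubbardSuperconductivity.HubbardSuperconductivity.Theorems.KLProgrammeC4aLoopIBPBounds

/-!
# Route `KLProgramme` — crux C4a, S3 brick (B4) «(B4)-UMK1», part 1: ONE integration by parts on a MONOTONE loop window WITH BOUNDARY TERMS
# (the first-order window lemma needed on the sub-windows of a fold cell, where the weight is not compactly supported)

Cell `gate-hubbard-kl`, seat hubbard-kl-k3c3-p3 (g27; row «implicit-function / monotonicity route for μ(n)»).  Located brick for the (C)-closer lane
hubbard-kl-c4a-1 (stub (C) `stub_twoLeg_curvature` of `KLRegimeEngineV17F2`, stmt-HubbardSuperconductivity-20437), design note HOME/hubbard-kl-k3c3-p3/B4-UMK1-DESIGN.md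
§4 (b)/(c): the umklapp FIRST-ORDER jet `∫ X(v)·∂_uK(e, ē(e,v)) dv` is priced by IBP in the loop angle wherever the partner band is monotone.  `…C4aLoopIBP` (g20) does this
for COMPACTLY SUPPORTED weights (partition-of-unity cells, no boundary terms); on the two monotone sub-windows of a FOLD cell the window ends at a distance `η` from
the fold point and the boundary terms `X·K(ē)/∂_vē` are part of the estimate (they are `≍ |ē_min|^{−3/2}/√c₂`, the size of the signed fold law).  This file:
* `hasDerivAt_div_deriv` (`(X/g′)′ = (X′g′ − Xg″)/g′²` where `g′ ≠ 0`);
* **`intervalIntegral_mul_deriv_comp_eq_boundary_sub`**: `g ∈ C²`, `g′ ≠ 0` on `[α,β]`, `X, K ∈ C¹` ⟹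
  `∫_{α..β} X·K′(g) = X(β)K(g β)/g′(β) − X(α)K(g α)/g′(α) − ∫_{α..β} ((X′g′ − Xg″)/g′²)·K(g)`;
* **`abs_intervalIntegral_mul_deriv_comp_le`**: with `|g′| ≥ σ`, `|g″| ≤ L₂`, `|X| ≤ X₀`, `|X′| ≤ X₁` on `[α,β]`:
  `|∫_{α..β} X·K′(g)| ≤ X₀(|K(g α)| + |K(g β)|)/σ + (X₁/σ + X₀L₂/σ²)·∫_{α..β} |K(g)|` — every derivative has left `K`; the price is `1/σ`, `L₂/σ²` and two point values.
Pure real analysis; nothing about the Hubbard model.  References: Salmhofer 1999 §4.5.3 (tangential case) [cite: Salmhofer1999]; FST II CPAM 51 (1998) §3 [cite: FeldmanSalmhoferTrubowitz1998].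
-/

noncomputable section

namespace Summit.HubbardSuperconductivity.HubbardSuperconductivity.Theorems.C4a

set_option linter.dupNamespace false -- summit = problem name (single-conjunct summit), D-0017

open Real Set MeasureTheory intervalIntegral

variable {g X K : ℝ → ℝ} {α β : ℝ}

/-- `(X/g′)′(x) = (X′(x)g′(x) − X(x)g″(x))/g′(x)²` at a point where `g′(x) ≠ 0` (`g ∈ C²`, `X ∈ C¹`). -/
theorem hasDerivAt_div_deriv (hg : ContDiff ℝ 2 g) (hX : ContDiff ℝ 1 X) {x : ℝ} (hx : deriv g x ≠ 0) :
    HasDerivAt (fun s => X s / deriv g s) ((deriv X x * deriv g x - X x * iteratedDeriv 2 g x) / deriv g x ^ 2) x := by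
  have hXd : HasDerivAt X (deriv X x) x := ((hX.differentiable one_ne_zero) x).hasDerivAt
  have hgd : HasDerivAt (deriv g) (iteratedDeriv 2 g x) x := by
    have hdiff : Differentiable ℝ (iteratedDeriv 1 g) := ContDiff.differentiable_iteratedDeriv 1 hg (by norm_num)
    have h := (hdiff x).hasDerivAt
    have e : iteratedDeriv 2 g = deriv (iteratedDeriv 1 g) := iteratedDeriv_succ
    rw [← e, iteratedDeriv_one] at h
    exact h
  exact hXd.div hgd hx

/-- **IBP ON A MONOTONE WINDOW WITH BOUNDARY TERMS**: `g ∈ C²` with `g′ ≠ 0` on `[α,β]` (`α ≤ β`), `X, K ∈ C¹` ⟹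
`∫_{α..β} X·K′(g) = X(β)K(g β)/g′(β) − X(α)K(g α)/g′(α) − ∫_{α..β} ((X′g′ − Xg″)/g′²)·K(g)`. [folklore] -/
theorem intervalIntegral_mul_deriv_comp_eq_boundary_sub (hαβ : α ≤ β) (hg : ContDiff ℝ 2 g) (hg' : ∀ s ∈ Icc α β, deriv g s ≠ 0)
    (hX : ContDiff ℝ 1 X) (hK : ContDiff ℝ 1 K) :
    ∫ v in α..β, X v * deriv K (g v) =
      X β / deriv g β * K (g β) - X α / deriv g α * K (g α) -
        ∫ v in α..β, (deriv X v * deriv g v - X v * iteratedDeriv 2 g v) / deriv g v ^ 2 * K (g v) := by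
  have hI : uIcc α β = Icc α β := uIcc_of_le hαβ
  -- the two factors and their derivatives on the window
  have hud : ∀ x ∈ uIcc α β, HasDerivAt (fun s => X s / deriv g s) ((deriv X x * deriv g x - X x * iteratedDeriv 2 g x) / deriv g x ^ 2) x :=
    fun x hx => hasDerivAt_div_deriv hg hX (hg' x (hI ▸ hx))
  have hgd : ∀ x, HasDerivAt g (deriv g x) x := fun x => ((hg.differentiable two_ne_zero) x).hasDerivAt
  have hKd : ∀ y, HasDerivAt K (deriv K y) y := fun y => ((hK.differentiable one_ne_zero) y).hasDerivAt
  have hvd : ∀ x ∈ uIcc α β, HasDerivAt (fun s => K (g s)) (deriv K (g x) * deriv g x) x := fun x _ => (hKd (g x)).comp x (hgd x)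
  -- interval integrability of the derivatives: both are continuous on the window
  have hgc : Continuous (deriv g) := hg.continuous_deriv (by norm_num)
  have hg2c : Continuous (iteratedDeriv 2 g) := hg.continuous_iteratedDeriv 2 le_rfl
  have hXc : Continuous X := hX.continuous
  have hX'c : Continuous (deriv X) := hX.continuous_deriv le_rfl
  have hu'c : ContinuousOn (fun x => (deriv X x * deriv g x - X x * iteratedDeriv 2 g x) / deriv g x ^ 2) (uIcc α β) := by
    refine ContinuousOn.div ?_ ?_ fun x hx => pow_ne_zero 2 (hg' x (hI ▸ hx))
    · exact ((hX'c.mul hgc).sub (hXc.mul hg2c)).continuousOn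
    · exact (hgc.pow 2).continuousOn
  have hv'c : Continuous fun x => deriv K (g x) * deriv g x := ((hK.continuous_deriv le_rfl).comp hg.continuous).mul hgc
  have hibp := intervalIntegral.integral_mul_deriv_eq_deriv_mul (u := fun s => X s / deriv g s) (v := fun s => K (g s)) hud hvd
    (hu'c.intervalIntegrable) (hv'c.intervalIntegrable α β)
  -- the left integrand is `X·K′(g)` on the window
  have hlhs : ∫ v in α..β, X v / deriv g v * (deriv K (g v) * deriv g v) = ∫ v in α..β, X v * deriv K (g v) := by
    refine intervalIntegral.integral_congr fun x hx => ?_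
    have hx' := hg' x (hI ▸ hx)
    field_simp
  rw [← hlhs, hibp]

/-- **THE WINDOW ESTIMATE**: `g ∈ C²`, `σ ≤ |g′|`, `|g″| ≤ L₂`, `|X| ≤ X₀`, `|X′| ≤ X₁` on `[α,β]`, `K ∈ C¹` ⟹
`|∫_{α..β} X·K′(g)| ≤ X₀(|K(g α)| + |K(g β)|)/σ + (X₁/σ + X₀L₂/σ²)·∫_{α..β} |K(g)|`. [cite: Salmhofer1999, §4.5.3] -/
theorem abs_intervalIntegral_mul_deriv_comp_le (hαβ : α ≤ β) (hg : ContDiff ℝ 2 g) (hX : ContDiff ℝ 1 X) (hK : ContDiff ℝ 1 K)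
    {σ L₂ X₀ X₁ : ℝ} (hσ : 0 < σ) (hgσ : ∀ v ∈ Icc α β, σ ≤ |deriv g v|) (hL₂ : ∀ v ∈ Icc α β, |iteratedDeriv 2 g v| ≤ L₂)
    (hX₀ : ∀ v ∈ Icc α β, |X v| ≤ X₀) (hX₁ : ∀ v ∈ Icc α β, |deriv X v| ≤ X₁) :
    |∫ v in α..β, X v * deriv K (g v)| ≤
      X₀ * (|K (g α)| + |K (g β)|) / σ + (X₁ / σ + X₀ * L₂ / σ ^ 2) * ∫ v in α..β, |K (g v)| := by
  have hg' : ∀ s ∈ Icc α β, deriv g s ≠ 0 := fun s hs h0 => by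
    have := hgσ s hs; rw [h0, abs_zero] at this; linarith
  have hα : α ∈ Icc α β := left_mem_Icc.2 hαβ
  have hβ : β ∈ Icc α β := right_mem_Icc.2 hαβ
  have hX₀0 : 0 ≤ X₀ := (abs_nonneg _).trans (hX₀ α hα)
  have hX₁0 : 0 ≤ X₁ := (abs_nonneg _).trans (hX₁ α hα)
  have hL₂0 : 0 ≤ L₂ := (abs_nonneg _).trans (hL₂ α hα)
  rw [intervalIntegral_mul_deriv_comp_eq_boundary_sub hαβ hg hg' hX hK]
  -- boundary terms
  have hbd : ∀ v ∈ Icc α β, |X v / deriv g v * K (g v)| ≤ X₀ * |K (g v)| / σ := fun v hv => by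
    rw [abs_mul, abs_div]
    have h1 : |X v| / |deriv g v| ≤ X₀ / σ := div_le_div₀ hX₀0 (hX₀ v hv) hσ (hgσ v hv)
    calc |X v| / |deriv g v| * |K (g v)| ≤ X₀ / σ * |K (g v)| := mul_le_mul_of_nonneg_right h1 (abs_nonneg _)
      _ = X₀ * |K (g v)| / σ := by ring
  -- the integral term
  have hint : |∫ v in α..β, (deriv X v * deriv g v - X v * iteratedDeriv 2 g v) / deriv g v ^ 2 * K (g v)| ≤
      (X₁ / σ + X₀ * L₂ / σ ^ 2) * ∫ v in α..β, |K (g v)| := by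
    rw [← intervalIntegral.integral_const_mul]
    refine (intervalIntegral.abs_integral_le_integral_abs hαβ).trans (intervalIntegral.integral_mono_on hαβ ?_ ?_ fun v hv => ?_)
    · have hgc : Continuous (deriv g) := hg.continuous_deriv (by norm_num)
      have hu'c : ContinuousOn (fun x => (deriv X x * deriv g x - X x * iteratedDeriv 2 g x) / deriv g x ^ 2 * K (g x)) (uIcc α β) := by
        refine (ContinuousOn.div ?_ ?_ fun x hx => pow_ne_zero 2 (hg' x ((uIcc_of_le hαβ) ▸ hx))).mul
          (hK.continuous.comp hg.continuous).continuousOn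
        · exact (((hX.continuous_deriv le_rfl).mul hgc).sub (hX.continuous.mul (hg.continuous_iteratedDeriv 2 le_rfl))).continuousOn
        · exact (hgc.pow 2).continuousOn
      exact hu'c.intervalIntegrable.abs
    · exact ((hK.continuous.comp hg.continuous).abs.intervalIntegrable α β).const_mul _
    · rw [abs_mul, abs_div, abs_pow]
      have hgv := hgσ v hv
      have hgpos : 0 < |deriv g v| := hσ.trans_le hgv
      have hnum : |deriv X v * deriv g v - X v * iteratedDeriv 2 g v| ≤ X₁ * |deriv g v| + X₀ * L₂ := by
        refine (abs_sub _ _).trans (add_le_add ?_ ?_)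
        · rw [abs_mul]; exact mul_le_mul_of_nonneg_right (hX₁ v hv) (abs_nonneg _)
        · rw [abs_mul]; exact mul_le_mul (hX₀ v hv) (hL₂ v hv) (abs_nonneg _) hX₀0
      have h1 : |deriv X v * deriv g v - X v * iteratedDeriv 2 g v| / |deriv g v| ^ 2 ≤ X₁ / σ + X₀ * L₂ / σ ^ 2 := by
        rw [div_le_iff₀ (by positivity)]
        have e1 : X₁ * |deriv g v| ≤ X₁ / σ * |deriv g v| ^ 2 := by
          rw [div_mul_eq_mul_div, le_div_iff₀ hσ]; nlinarith [mul_nonneg hX₁0 (abs_nonneg (deriv g v))]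
        have e2 : X₀ * L₂ ≤ X₀ * L₂ / σ ^ 2 * |deriv g v| ^ 2 := by
          rw [div_mul_eq_mul_div, le_div_iff₀ (by positivity)]
          have := mul_le_mul hgv hgv hσ.le (abs_nonneg _)
          nlinarith [mul_nonneg hX₀0 hL₂0]
        nlinarith
      exact mul_le_mul_of_nonneg_right h1 (abs_nonneg _)
  have h1 := hbd α hα
  have h2 := hbd β hβ
  calc |X β / deriv g β * K (g β) - X α / deriv g α * K (g α) -
          ∫ v in α..β, (deriv X v * deriv g v - X v * iteratedDeriv 2 g v) / deriv g v ^ 2 * K (g v)|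
      ≤ |X β / deriv g β * K (g β)| + |X α / deriv g α * K (g α)| +
          |∫ v in α..β, (deriv X v * deriv g v - X v * iteratedDeriv 2 g v) / deriv g v ^ 2 * K (g v)| := by
        refine (abs_sub _ _).trans (add_le_add (abs_sub _ _) le_rfl)
    _ ≤ X₀ * |K (g β)| / σ + X₀ * |K (g α)| / σ + (X₁ / σ + X₀ * L₂ / σ ^ 2) * ∫ v in α..β, |K (g v)| := add_le_add (add_le_add h2 h1) hint
    _ = X₀ * (|K (g α)| + |K (g β)|) / σ + (X₁ / σ + X₀ * L₂ / σ ^ 2) * ∫ v in α..β, |K (g v)| := by ring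

end Summit.HubbardSuperconductivity.HubbardSuperconductivity.Theorems.C4a

end
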